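import Literature.NumberTheory.ModularForms.InterpolationKernels
import Literature.NumberTheory.ModularForms.QAsymptotics
import HarnessLib

/-!
# The bound (4.14) for `𝒦₊^{(8)}`: `𝒦₊^{(8)}(τ, z) = O(|τ| e^{−2π Im τ})` as `Im τ → ∞`

Cohn–Kumar–Miller–Radchenko–Viazovska, Ann. of Math. 196 (2022) = arXiv:1902.05438, §4.4 (4.14):
"a q-expansion calculation using these explicit formulas shows that for fixed `z` and `τ → ∞`,
`𝒦₊^{(8)}(τ,z), 𝒦₋^{(8)}(τ,z) = O(|τ e^{2πiτ}|)` …, so (4) holds."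

PROVED here for `𝒦₊^{(8)}` and fixed `z`, as `IsBigO` along `atImInfty`, from the first-order
asymptotics of `QAsymptotics.lean`: off the (eventually absent) poles,
`𝒦₊^{(8)} = cφ̃₋₂(z)[φ₋₂(E₆−1) − 2φ₀(E₄−1) + φ₂(E₁₄/(Δ(j−j(z))) − 1) + (φ₋₂ − 2φ₀ + φ₂)]`
`  + (c/Δ(z))[φ₋₂E₆E₈(z)φ̃₂(z) − 2φ₀E₄E₁₀(z)φ̃₀(z)]/(j − j(z))`, `c = π²/(36i)`,
and every bracket is `O(|τ|q)` (`φⱼ = O(|τ|)`, `E₄ − 1, E₆ − 1, (j−j(z))⁻¹ = O(q)`,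
`φ₋₂ − 2φ₀ + φ₂ = τ(1−E₂)² + (6i/π)(1−E₂) = O(|τ|q)`).

## References

* H. Cohn, A. Kumar, S. D. Miller, D. Radchenko, M. Viazovska, Ann. of Math. 196 (2022),
  arXiv:1902.05438, Theorem 4.1 (4), §4.4 (4.14). [CohnEtAl2019]
-/

noncomputable section

open Complex hiding I
open Filter Topology Asymptotics ModularForm SlashInvariantForm EisensteinSeries
open UpperHalfPlane hiding I
open Complex (I)
open scoped Real MatrixGroups ModularForm Manifold

namespace Literature.NumberTheory.ModularForms

open Literature.NumberTheory.EllipticCurves.ModularForms (kleinJ E₄_cube_eq_kleinJ_mul)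

/-- A function bounded at `i∞` times an `O(|τ|)` function is `O(|τ|)`; times `O(q)` is `O(q)`:
general form `f = O(1)`, `g = O(k)` ⟹ `fg = O(k)`. [folklore] -/
theorem isBigO_mul_of_bounded {f g : ℍ → ℂ} {k : ℍ → ℝ} (hf : IsBoundedAtImInfty f)
    (hg : g =O[atImInfty] k) : (fun τ => f τ * g τ) =O[atImInfty] k := by
  have hf' : f =O[atImInfty] (fun _ : ℍ => (1 : ℝ)) := hf
  have := hf'.mul hg
  simpa using this

/-- **(4.14) for `𝒦₊^{(8)}`**: for fixed `z`, `𝒦₊^{(8)}(τ, z) = O(|τ| e^{−2π Im τ})` as `Im τ → ∞`.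
[cite: CohnEtAl2019, §4.4 (4.14)] -/
theorem kernelPlus8_isBigO (z : ℍ) :
    (fun τ => kernelPlus8 τ z) =O[atImInfty] fun τ : ℍ => ‖(τ : ℂ)‖ * expDecay τ := by
  set c : ℂ := (π : ℂ) ^ 2 / (36 * I) with hc
  -- the pieces
  have hA : (fun τ => phiNeg2 τ * (E₆ τ - 1)) =O[atImInfty] fun τ : ℍ => ‖(τ : ℂ)‖ * expDecay τ :=
    phiNeg2_isBigO.mul E₆_sub_one_isBigO
  have hB : (fun τ => phi0 τ * (E₄ τ - 1)) =O[atImInfty] fun τ : ℍ => ‖(τ : ℂ)‖ * expDecay τ :=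
    phi0_isBigO.mul E₄_sub_one_isBigO
  have hC : (fun τ => phi2 τ * (E₄ τ * E₄ τ * E₆ τ * (ModularForm.discriminant τ)⁻¹ * (kleinJ τ - kleinJ z)⁻¹ - 1))
      =O[atImInfty] fun τ : ℍ => ‖(τ : ℂ)‖ * expDecay τ :=
    phi2_isBigO.mul (f2_div_sub_one_isBigO z)
  have hD := phi_alt_sum_isBigO
  have hE : (fun τ => (phiNeg2 τ * E₆ τ * (E8fun z * phiTilde2 z) - 2 * phi0 τ * E₄ τ * (E10fun z * phiTilde0 z)) *
      (kleinJ τ - kleinJ z)⁻¹) =O[atImInfty] fun τ : ℍ => ‖(τ : ℂ)‖ * expDecay τ := by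
    have h1 : (fun τ => phiNeg2 τ * E₆ τ * (E8fun z * phiTilde2 z)) =O[atImInfty] fun τ : ℍ => ‖(τ : ℂ)‖ := by
      have h := (isBigO_mul_of_bounded (ModularFormClass.bdd_at_infty E₆) phiNeg2_isBigO).const_mul_left
        (E8fun z * phiTilde2 z)
      exact h.congr_left fun τ => by ring
    have h2 : (fun τ => 2 * phi0 τ * E₄ τ * (E10fun z * phiTilde0 z)) =O[atImInfty] fun τ : ℍ => ‖(τ : ℂ)‖ := by
      have h := (isBigO_mul_of_bounded (ModularFormClass.bdd_at_infty E₄) phi0_isBigO).const_mul_left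
        (2 * (E10fun z * phiTilde0 z))
      exact h.congr_left fun τ => by ring
    exact (h1.sub h2).mul (inv_kleinJ_sub_isBigO z)
  -- assemble
  have hsum := ((((hA.sub (hB.const_mul_left 2)).add hC).add hD).const_mul_left (c * phiTildeNeg2 z)).add
    (hE.const_mul_left (c / ModularForm.discriminant z))
  refine hsum.congr' ?_ EventuallyEq.rfl
  filter_upwards [eventually_kleinJ_ne z] with τ hJ
  have hΔz := ModularForm.discriminant_ne_zero z
  have hΔ := ModularForm.discriminant_ne_zero τ
  simp only [kernelPlus8, f2fun, E14fun, Pi.mul_apply, Pi.inv_apply, hc]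
  field_simp
  ring

end Literature.NumberTheory.ModularForms
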